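import Mathlib
import Summits.CriticalPhenomena.PercolationContinuityZ3.Theorems.PercNearOneGluingNoHeavyLowerTailAntiBandDegenerate

/-!
# `NoHeavyLowerTail` (crux stmt-CriticalPhenomena-4575), lane prim-ineq-gen-4 (gen 35): the LEVEL-vs-BALL reduction of the anti-band conjecture

Support file (`--supports stmt-CriticalPhenomena-4575`; memo `run/shared/lean/prim/prim-ineq-gen-4/FINDING-LEVEL-BALL-g35.md`).
Pure finite combinatorics over `ℤ`, no definitions, no `sorry`, standard axioms.

Notation (in this docstring only).  For a family `W` of finsets of `β` (`Fintype.card β = n`) let `ψ_W(s) = [s ∈ W] − [sᶜ ∈ W] ∈ {−1,0,1}`; for upper sets `W, V` the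
anti-band inequality (AB_k)(n) of the lane, `#{s ∈ W ∩ Vᶜˢ | #s < k ∨ #sᶜ < k} ≤ #{s ∈ W ∩ V | #s < k ∨ #sᶜ < k}`, is `0 ≤ ∑_{#s<k} ψ_W ψ_V`
(`sum_outer_eq`, `antiBand_iff_ballSum_nonneg`).  Write `S_j = ∑_{#s = j} ψ_W ψ_V` (level sum) and `P_j = ∑_{#s ≤ j} ψ_W ψ_V` (ball sum).

Gen 35 found (exact facet computation of the cone of level profiles at `n ≤ 7`, exhaustive / randomised / annealed verification for `n ≤ 11`) that for
OPPOSITE-SHIFTED pairs (`W` left-, `V` right-shifted) the running ball average `P_{k}/|B_k|` is non-increasing for `k ≤ ⌈n/2⌉`, i.e. the level-vs-ball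
inequalities  (LEV_k)  `|B_{k−1}| · S_k ≤ C(n,k) · P_{k−1}`  hold, and that the middle-level case at odd `n = 2m+1`,
(MID) `2^n · S_m ≤ C(n,m) · ∑_all ψ_W ψ_V`, is a facet.  This file records, for an ARBITRARY pair of families, the formal implications

* `ballSum_nonneg_of_levelBall`     : `P_K ≥ 0` and (LEV_j) for `k ≤ j ≤ K`  ⇒  `P_{k−1} ≥ 0`;
* `ballSum_nonneg_of_levelBall_odd` : `n = 2m+1`: (LEV_j) for `k ≤ j ≤ m` ⇒ `P_{k−1} ≥ 0` (uses `P_m = ½ ∑_all ≥ 0`, Harris–Kleitman);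
* `ballSum_nonneg_of_mid`           : `n = 2m+1`: (MID) ⇒ `P_{m−1} ≥ 0`, i.e. the NEXT-TO-DIAGONAL cell (AB_m)(2m+1) for that pair;
* `antiBand_of_mid`                 : the same in the lane's `#{…} ≤ #{…}` form,

so that the whole anti-band programme for a pair reduces to single-level comparisons.  (The shift reduction "all pairs ⇐ opposite-shifted pairs" is
`AntiBandShiftReduction` / `AntiBandCylinderShifted.antiBand_of_forall_rightShifted`, gen 20/34, and is not repeated here.)
-/

namespace Summit.CriticalPhenomena.PercolationContinuityZ3.Theorems.AntiBandLevelBall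

open Finset
open scoped FinsetFamily

variable {β : Type*} [DecidableEq β] [Fintype β]

/-- Re-indexing a sum over a complement-closed family by complementation. [folklore] -/
theorem sum_compl_eq_sum {O : Finset (Finset β)} (hO : ∀ s, s ∈ O ↔ sᶜ ∈ O) (f : Finset β → ℤ) :
    ∑ s ∈ O, f sᶜ = ∑ s ∈ O, f s :=
  sum_nbij' (fun s => sᶜ) (fun s => sᶜ) (fun s hs => (hO s).1 hs) (fun s hs => (hO s).1 hs)
    (fun s _ => compl_compl s) (fun s _ => compl_compl s) (fun _ _ => rfl)

/-- `ψ_W(sᶜ) = −ψ_W(s)`. [folklore] -/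
theorem psi_compl (W : Finset (Finset β)) (s : Finset β) : (((if sᶜ ∈ W then (1 : ℤ) else 0) - (if sᶜᶜ ∈ W then (1 : ℤ) else 0))) = -(((if s ∈ W then (1 : ℤ) else 0) - (if sᶜ ∈ W then (1 : ℤ) else 0))) := by
  rw [compl_compl]; ring

omit [Fintype β] in
/-- A sum of indicator products is a cardinality: `∑_{s ∈ O} [s ∈ W][s ∈ V] = #(W ∩ V ∩ O)`. [folklore] -/
theorem sum_ite_mul_ite_eq_card (W V O : Finset (Finset β)) :
    ∑ s ∈ O, (if s ∈ W then (1 : ℤ) else 0) * (if s ∈ V then (1 : ℤ) else 0) = #(W ∩ V ∩ O) := by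
  rw [← sum_filter_add_sum_filter_not O (fun s => s ∈ W ∩ V)]
  have h1 : ∑ s ∈ O.filter (fun s => s ∈ W ∩ V), (if s ∈ W then (1 : ℤ) else 0) * (if s ∈ V then (1 : ℤ) else 0)
      = ∑ s ∈ O.filter (fun s => s ∈ W ∩ V), (1 : ℤ) := by
    refine sum_congr rfl fun s hs => ?_
    rw [mem_filter, mem_inter] at hs
    rw [if_pos hs.2.1, if_pos hs.2.2, mul_one]
  have h2 : ∑ s ∈ O.filter (fun s => ¬ s ∈ W ∩ V), (if s ∈ W then (1 : ℤ) else 0) * (if s ∈ V then (1 : ℤ) else 0) = 0 := by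
    refine sum_eq_zero fun s hs => ?_
    rw [mem_filter, mem_inter, not_and_or] at hs
    rcases hs.2 with h | h
    · rw [if_neg h, zero_mul]
    · rw [if_neg h, mul_zero]
  rw [h1, h2, add_zero, sum_const, nsmul_eq_mul, mul_one]
  congr 1
  congr 1
  ext s
  rw [mem_filter, mem_inter, mem_inter, mem_inter]
  tauto

/-- **The correlation sum over a complement-closed family.**  For any families `W, V` and any complement-closed `O`:
`∑_{s ∈ O} ψ_W(s) ψ_V(s) = 2·(#(W ∩ V ∩ O) − #(W ∩ Vᶜˢ ∩ O))`. [this work, bookkeeping] -/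
theorem sum_psi_mul_psi_eq (W V : Finset (Finset β)) {O : Finset (Finset β)} (hO : ∀ s, s ∈ O ↔ sᶜ ∈ O) :
    ∑ s ∈ O, (((if s ∈ W then (1 : ℤ) else 0) - (if sᶜ ∈ W then (1 : ℤ) else 0))) * (((if s ∈ V then (1 : ℤ) else 0) - (if sᶜ ∈ V then (1 : ℤ) else 0))) = 2 * ((#(W ∩ V ∩ O) : ℤ) - #(W ∩ Vᶜˢ ∩ O)) := by
  have e1 : ∀ s : Finset β, (((if s ∈ W then (1 : ℤ) else 0) - (if sᶜ ∈ W then (1 : ℤ) else 0))) * (((if s ∈ V then (1 : ℤ) else 0) - (if sᶜ ∈ V then (1 : ℤ) else 0)))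
      = ((if s ∈ W then (1:ℤ) else 0) * (if s ∈ V then (1:ℤ) else 0)
        + (if sᶜ ∈ W then (1:ℤ) else 0) * (if sᶜ ∈ V then (1:ℤ) else 0))
        - ((if s ∈ W then (1:ℤ) else 0) * (if sᶜ ∈ V then (1:ℤ) else 0)
        + (if sᶜ ∈ W then (1:ℤ) else 0) * (if s ∈ V then (1:ℤ) else 0)) := fun s => by ring
  simp_rw [e1]
  rw [sum_sub_distrib, sum_add_distrib, sum_add_distrib]
  have hA := sum_compl_eq_sum hO (fun s => (if s ∈ W then (1:ℤ) else 0) * (if s ∈ V then (1:ℤ) else 0))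
  have hB := sum_compl_eq_sum hO (fun s => (if s ∈ W then (1:ℤ) else 0) * (if sᶜ ∈ V then (1:ℤ) else 0))
  simp only [compl_compl] at hA hB
  have hB' : ∑ s ∈ O, (if sᶜ ∈ W then (1:ℤ) else 0) * (if s ∈ V then (1:ℤ) else 0)
      = ∑ s ∈ O, (if s ∈ W then (1:ℤ) else 0) * (if sᶜ ∈ V then (1:ℤ) else 0) := by
    rw [← hB]
  rw [hA, hB', sum_ite_mul_ite_eq_card]
  have hC : ∑ s ∈ O, (if s ∈ W then (1:ℤ) else 0) * (if sᶜ ∈ V then (1:ℤ) else 0) = #(W ∩ Vᶜˢ ∩ O) := by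
    rw [← sum_ite_mul_ite_eq_card W Vᶜˢ O]
    refine sum_congr rfl fun s _ => ?_
    simp only [mem_compls]
  rw [hC]; ring

/-- The two-sided outer region `{#s < k ∨ #sᶜ < k}` is complement-closed. [folklore] -/
theorem mem_outer_iff_compl (k : ℕ) (s : Finset β) :
    s ∈ (univ : Finset (Finset β)).filter (fun s => #s < k ∨ #sᶜ < k)
      ↔ sᶜ ∈ (univ : Finset (Finset β)).filter (fun s => #s < k ∨ #sᶜ < k) := by
  simp only [mem_filter, mem_univ, true_and, compl_compl]; tauto

/-- **(AB) as a sign condition.**  For any families `W, V`: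
`#{s ∈ W ∩ Vᶜˢ | #s<k ∨ #sᶜ<k} ≤ #{s ∈ W ∩ V | #s<k ∨ #sᶜ<k}` iff `0 ≤ ∑_{#s<k ∨ #sᶜ<k} ψ_W ψ_V`. [this work, bookkeeping] -/
theorem antiBand_iff_outerSum_nonneg (k : ℕ) (W V : Finset (Finset β)) :
    #((W ∩ Vᶜˢ).filter fun s => #s < k ∨ #sᶜ < k) ≤ #((W ∩ V).filter fun s => #s < k ∨ #sᶜ < k)
      ↔ 0 ≤ ∑ s ∈ (univ : Finset (Finset β)).filter (fun s => #s < k ∨ #sᶜ < k), (((if s ∈ W then (1 : ℤ) else 0) - (if sᶜ ∈ W then (1 : ℤ) else 0))) * (((if s ∈ V then (1 : ℤ) else 0) - (if sᶜ ∈ V then (1 : ℤ) else 0))) := by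
  rw [sum_psi_mul_psi_eq W V (mem_outer_iff_compl k)]
  have e1 : W ∩ V ∩ (univ : Finset (Finset β)).filter (fun s => #s < k ∨ #sᶜ < k) = (W ∩ V).filter fun s => #s < k ∨ #sᶜ < k := by
    ext s; simp only [mem_inter, mem_filter, mem_univ, true_and]
  have e2 : W ∩ Vᶜˢ ∩ (univ : Finset (Finset β)).filter (fun s => #s < k ∨ #sᶜ < k) = (W ∩ Vᶜˢ).filter fun s => #s < k ∨ #sᶜ < k := by
    ext s; simp only [mem_inter, mem_filter, mem_univ, true_and]
  rw [e1, e2]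
  constructor
  · intro h; have : (#((W ∩ Vᶜˢ).filter fun s => #s < k ∨ #sᶜ < k) : ℤ) ≤ #((W ∩ V).filter fun s => #s < k ∨ #sᶜ < k) := by exact_mod_cast h
    linarith
  · intro h; have : (#((W ∩ Vᶜˢ).filter fun s => #s < k ∨ #sᶜ < k) : ℤ) ≤ #((W ∩ V).filter fun s => #s < k ∨ #sᶜ < k) := by linarith
    exact_mod_cast this

/-- The outer sum is twice the ball sum: for `2k ≤ n + 1`, `∑_{#s<k ∨ #sᶜ<k} ψ_W ψ_V = 2 ∑_{#s<k} ψ_W ψ_V`. [this work, bookkeeping] -/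
theorem outerSum_eq_two_mul_ballSum (k : ℕ) (hk : 2 * k ≤ Fintype.card β + 1) (W V : Finset (Finset β)) :
    ∑ s ∈ (univ : Finset (Finset β)).filter (fun s => #s < k ∨ #sᶜ < k), (((if s ∈ W then (1 : ℤ) else 0) - (if sᶜ ∈ W then (1 : ℤ) else 0))) * (((if s ∈ V then (1 : ℤ) else 0) - (if sᶜ ∈ V then (1 : ℤ) else 0)))
      = 2 * ∑ s ∈ (univ : Finset (Finset β)).filter (fun s => #s < k), (((if s ∈ W then (1 : ℤ) else 0) - (if sᶜ ∈ W then (1 : ℤ) else 0))) * (((if s ∈ V then (1 : ℤ) else 0) - (if sᶜ ∈ V then (1 : ℤ) else 0))) := by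
  have hsplit : (univ : Finset (Finset β)).filter (fun s => #s < k ∨ #sᶜ < k)
      = (univ : Finset (Finset β)).filter (fun s => #s < k) ∪ (univ : Finset (Finset β)).filter (fun s => #sᶜ < k) := by
    ext s; simp only [mem_filter, mem_univ, true_and, mem_union]
  have hdisj : Disjoint ((univ : Finset (Finset β)).filter (fun s => #s < k)) ((univ : Finset (Finset β)).filter (fun s => #sᶜ < k)) := by
    rw [disjoint_filter]; intro s _ h1 h2
    have := card_add_card_compl s
    omega
  rw [hsplit, sum_union hdisj, two_mul]
  congr 1
  -- reindex the second sum by complementation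
  refine sum_nbij' (fun s => sᶜ) (fun s => sᶜ) ?_ ?_ (fun s _ => compl_compl s) (fun s _ => compl_compl s) ?_
  · intro s hs; rw [mem_filter] at hs ⊢; exact ⟨mem_univ _, hs.2⟩
  · intro s hs; rw [mem_filter] at hs ⊢; refine ⟨mem_univ _, ?_⟩; rw [compl_compl]; exact hs.2
  · intro s _; rw [psi_compl W s, psi_compl V s]; ring

/-- **Harris–Kleitman for the correlation sum.**  For upper sets `W, V`: `0 ≤ ∑_all ψ_W ψ_V` (`= 2(#(W∩V) − #(W∩Vᶜˢ))`, and `#(W ∩ Vᶜˢ) ≤ #(W ∩ V)` is Kleitman's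
lemma twice, `AntiBandDegenerate.card_inter_le_card_compls_inter`). [Harris 1960; Kleitman 1966] -/
theorem totalSum_nonneg (W V : Finset (Finset β)) (hW : IsUpperSet (W : Set (Finset β))) (hV : IsUpperSet (V : Set (Finset β))) :
    0 ≤ ∑ s ∈ (univ : Finset (Finset β)), (((if s ∈ W then (1 : ℤ) else 0) - (if sᶜ ∈ W then (1 : ℤ) else 0))) * (((if s ∈ V then (1 : ℤ) else 0) - (if sᶜ ∈ V then (1 : ℤ) else 0))) := by
  rw [sum_psi_mul_psi_eq W V (O := univ) (fun s => by simp only [mem_univ])]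
  have hN : IsLowerSet ((Vᶜˢ : Finset (Finset β)) : Set (Finset β)) := by
    intro a b hba ha
    rw [mem_coe, mem_compls] at ha ⊢
    exact hV (compl_subset_compl.2 hba) ha
  have h := AntiBandDegenerate.card_inter_le_card_compls_inter Vᶜˢ W hN hW
  rw [compls_compls, inter_comm, inter_comm V] at h
  have h' : (#(W ∩ Vᶜˢ) : ℤ) ≤ #(W ∩ V) := by exact_mod_cast h
  rw [inter_univ, inter_univ]; linarith

/-- The total sum is twice the half-ball sum at odd size: `n = 2m+1` ⇒ `∑_all ψ_W ψ_V = 2 ∑_{#s ≤ m} ψ_W ψ_V`. [this work, bookkeeping] -/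
theorem totalSum_eq_two_mul_halfBall (m : ℕ) (hn : Fintype.card β = 2 * m + 1) (W V : Finset (Finset β)) :
    ∑ s ∈ (univ : Finset (Finset β)), (((if s ∈ W then (1 : ℤ) else 0) - (if sᶜ ∈ W then (1 : ℤ) else 0))) * (((if s ∈ V then (1 : ℤ) else 0) - (if sᶜ ∈ V then (1 : ℤ) else 0)))
      = 2 * ∑ s ∈ (univ : Finset (Finset β)).filter (fun s => #s < m + 1), (((if s ∈ W then (1 : ℤ) else 0) - (if sᶜ ∈ W then (1 : ℤ) else 0))) * (((if s ∈ V then (1 : ℤ) else 0) - (if sᶜ ∈ V then (1 : ℤ) else 0))) := by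
  rw [← outerSum_eq_two_mul_ballSum (m + 1) (by omega) W V]
  have hO : (univ : Finset (Finset β)).filter (fun s => #s < m + 1 ∨ #sᶜ < m + 1) = univ := by
    apply filter_true_of_mem
    intro s _
    have := card_add_card_compl s
    omega
  rw [hO]

/-- **Level-vs-ball reduction (general form).**  Let `k ≤ K + 1`... precisely: if the ball sum `P_K = ∑_{#s ≤ K} ψ_Wψ_V` is `≥ 0` and for every
`j` with `k ≤ j ≤ K` the level-vs-ball inequality (LEV_j) `|B_{j−1}|·S_j ≤ C(n,j)·P_{j−1}` holds, then `P_{k−1} = ∑_{#s<k} ψ_Wψ_V ≥ 0`.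
(Downward induction: `P_{j−1}·(1 + C(n,j)/|B_{j−1}|) ≥ P_j`.)  Valid for ANY two families. [this work] -/
theorem ballSum_nonneg_of_levelBall (W V : Finset (Finset β)) (k K : ℕ) (hkK : k ≤ K + 1)
    (hK : 0 ≤ ∑ s ∈ (univ : Finset (Finset β)).filter (fun s => #s < K + 1), (((if s ∈ W then (1 : ℤ) else 0) - (if sᶜ ∈ W then (1 : ℤ) else 0))) * (((if s ∈ V then (1 : ℤ) else 0) - (if sᶜ ∈ V then (1 : ℤ) else 0))))
    (hlev : ∀ j, k ≤ j → j ≤ K →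
      (#((univ : Finset (Finset β)).filter fun s => #s < j) : ℤ) * ∑ s ∈ (univ : Finset (Finset β)).filter (fun s => #s = j), (((if s ∈ W then (1 : ℤ) else 0) - (if sᶜ ∈ W then (1 : ℤ) else 0))) * (((if s ∈ V then (1 : ℤ) else 0) - (if sᶜ ∈ V then (1 : ℤ) else 0)))
        ≤ (((Fintype.card β).choose j : ℕ) : ℤ) * ∑ s ∈ (univ : Finset (Finset β)).filter (fun s => #s < j), (((if s ∈ W then (1 : ℤ) else 0) - (if sᶜ ∈ W then (1 : ℤ) else 0))) * (((if s ∈ V then (1 : ℤ) else 0) - (if sᶜ ∈ V then (1 : ℤ) else 0)))) :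
    0 ≤ ∑ s ∈ (univ : Finset (Finset β)).filter (fun s => #s < k), (((if s ∈ W then (1 : ℤ) else 0) - (if sᶜ ∈ W then (1 : ℤ) else 0))) * (((if s ∈ V then (1 : ℤ) else 0) - (if sᶜ ∈ V then (1 : ℤ) else 0))) := by
  -- downward induction on the gap K + 1 - k
  obtain ⟨d, hd⟩ : ∃ d, K + 1 = k + d := ⟨K + 1 - k, by omega⟩
  induction d generalizing k with
  | zero => rw [show k = K + 1 by omega]; exact hK
  | succ d ih =>
    have hk : k ≤ K := by omega
    have hnext : 0 ≤ ∑ s ∈ (univ : Finset (Finset β)).filter (fun s => #s < k + 1), (((if s ∈ W then (1 : ℤ) else 0) - (if sᶜ ∈ W then (1 : ℤ) else 0))) * (((if s ∈ V then (1 : ℤ) else 0) - (if sᶜ ∈ V then (1 : ℤ) else 0))) :=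
      ih (k + 1) (by omega) (fun j hj hjK => hlev j (by omega) hjK) (by omega)
    -- split the (k+1)-ball into the k-ball and the level k
    have hsplit : ∑ s ∈ (univ : Finset (Finset β)).filter (fun s => #s < k + 1), (((if s ∈ W then (1 : ℤ) else 0) - (if sᶜ ∈ W then (1 : ℤ) else 0))) * (((if s ∈ V then (1 : ℤ) else 0) - (if sᶜ ∈ V then (1 : ℤ) else 0)))
        = ∑ s ∈ (univ : Finset (Finset β)).filter (fun s => #s < k), (((if s ∈ W then (1 : ℤ) else 0) - (if sᶜ ∈ W then (1 : ℤ) else 0))) * (((if s ∈ V then (1 : ℤ) else 0) - (if sᶜ ∈ V then (1 : ℤ) else 0)))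
          + ∑ s ∈ (univ : Finset (Finset β)).filter (fun s => #s = k), (((if s ∈ W then (1 : ℤ) else 0) - (if sᶜ ∈ W then (1 : ℤ) else 0))) * (((if s ∈ V then (1 : ℤ) else 0) - (if sᶜ ∈ V then (1 : ℤ) else 0))) := by
      rw [← sum_union]
      · congr 1; ext s; simp only [mem_filter, mem_univ, true_and, mem_union]; omega
      · rw [disjoint_filter]; intro s _ h1 h2; omega
    have hl := hlev k le_rfl hk
    set P := ∑ s ∈ (univ : Finset (Finset β)).filter (fun s => #s < k), (((if s ∈ W then (1 : ℤ) else 0) - (if sᶜ ∈ W then (1 : ℤ) else 0))) * (((if s ∈ V then (1 : ℤ) else 0) - (if sᶜ ∈ V then (1 : ℤ) else 0))) with hP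
    set S := ∑ s ∈ (univ : Finset (Finset β)).filter (fun s => #s = k), (((if s ∈ W then (1 : ℤ) else 0) - (if sᶜ ∈ W then (1 : ℤ) else 0))) * (((if s ∈ V then (1 : ℤ) else 0) - (if sᶜ ∈ V then (1 : ℤ) else 0))) with hS
    set B : ℤ := ((#((univ : Finset (Finset β)).filter fun s => #s < k) : ℕ) : ℤ) with hB
    set C : ℤ := (((Fintype.card β).choose k : ℕ) : ℤ) with hC
    rw [hsplit] at hnext
    -- B ≥ 0, C ≥ 1 (if k ≤ n) ... handle k > n separately: then the level k is empty and S = 0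
    by_cases hkn : k ≤ Fintype.card β
    · have hCpos : 0 < C := by rw [hC]; exact_mod_cast Nat.choose_pos hkn
      have hBnn : 0 ≤ B := by rw [hB]; exact_mod_cast Nat.zero_le _
      -- from B*S ≤ C*P and P + S ≥ 0:  (B + C) * P ≥ B * P + B * S... precisely C*P ≥ B*S ≥ B*(-P) gives (B+C)P ≥ 0
      nlinarith
    · have hS0 : S = 0 := by
        rw [hS]; refine sum_eq_zero fun s hs => ?_
        rw [mem_filter] at hs
        have := card_le_univ s; omega
      rw [hS0, add_zero] at hnext; exact hnext

/-- **Odd size: the level-vs-ball inequalities up to the middle give every anti-band cell.**  `n = 2m+1`, `W, V` upper sets: if (LEV_j) holds for all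
`k ≤ j ≤ m` then `∑_{#s<k} ψ_Wψ_V ≥ 0` (since `P_m = ½∑_all ≥ 0` by Harris–Kleitman). [this work] -/
theorem ballSum_nonneg_of_levelBall_odd (m : ℕ) (hn : Fintype.card β = 2 * m + 1) (W V : Finset (Finset β))
    (hW : IsUpperSet (W : Set (Finset β))) (hV : IsUpperSet (V : Set (Finset β))) (k : ℕ) (hk : k ≤ m + 1)
    (hlev : ∀ j, k ≤ j → j ≤ m →
      (#((univ : Finset (Finset β)).filter fun s => #s < j) : ℤ) * ∑ s ∈ (univ : Finset (Finset β)).filter (fun s => #s = j), (((if s ∈ W then (1 : ℤ) else 0) - (if sᶜ ∈ W then (1 : ℤ) else 0))) * (((if s ∈ V then (1 : ℤ) else 0) - (if sᶜ ∈ V then (1 : ℤ) else 0)))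
        ≤ (((Fintype.card β).choose j : ℕ) : ℤ) * ∑ s ∈ (univ : Finset (Finset β)).filter (fun s => #s < j), (((if s ∈ W then (1 : ℤ) else 0) - (if sᶜ ∈ W then (1 : ℤ) else 0))) * (((if s ∈ V then (1 : ℤ) else 0) - (if sᶜ ∈ V then (1 : ℤ) else 0)))) :
    0 ≤ ∑ s ∈ (univ : Finset (Finset β)).filter (fun s => #s < k), (((if s ∈ W then (1 : ℤ) else 0) - (if sᶜ ∈ W then (1 : ℤ) else 0))) * (((if s ∈ V then (1 : ℤ) else 0) - (if sᶜ ∈ V then (1 : ℤ) else 0))) := by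
  refine ballSum_nonneg_of_levelBall W V k m hk ?_ hlev
  have h := totalSum_nonneg W V hW hV
  rw [totalSum_eq_two_mul_halfBall m hn] at h
  linarith

/-- **The middle-level inequality gives the next-to-diagonal cell.**  `n = 2m+1`, `W, V` upper sets: if
(MID) `2^n · S_m ≤ C(n,m) · ∑_all ψ_Wψ_V` then `P_{m−1} = ∑_{#s<m} ψ_Wψ_V ≥ 0`
(because `P_{m−1} = ½∑_all − S_m ≥ (½ − C(n,m)/2^n)∑_all` and `2·C(2m+1,m) ≤ 2^{2m+1}`). [this work] -/
theorem ballSum_nonneg_of_mid (m : ℕ) (hn : Fintype.card β = 2 * m + 1) (W V : Finset (Finset β))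
    (hW : IsUpperSet (W : Set (Finset β))) (hV : IsUpperSet (V : Set (Finset β)))
    (hmid : (2 : ℤ) ^ (2 * m + 1) * ∑ s ∈ (univ : Finset (Finset β)).filter (fun s => #s = m), (((if s ∈ W then (1 : ℤ) else 0) - (if sᶜ ∈ W then (1 : ℤ) else 0))) * (((if s ∈ V then (1 : ℤ) else 0) - (if sᶜ ∈ V then (1 : ℤ) else 0)))
        ≤ (((2 * m + 1).choose m : ℕ) : ℤ) * ∑ s ∈ (univ : Finset (Finset β)), (((if s ∈ W then (1 : ℤ) else 0) - (if sᶜ ∈ W then (1 : ℤ) else 0))) * (((if s ∈ V then (1 : ℤ) else 0) - (if sᶜ ∈ V then (1 : ℤ) else 0)))) :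
    0 ≤ ∑ s ∈ (univ : Finset (Finset β)).filter (fun s => #s < m), (((if s ∈ W then (1 : ℤ) else 0) - (if sᶜ ∈ W then (1 : ℤ) else 0))) * (((if s ∈ V then (1 : ℤ) else 0) - (if sᶜ ∈ V then (1 : ℤ) else 0))) := by
  have htot := totalSum_nonneg W V hW hV
  have hhalf := totalSum_eq_two_mul_halfBall m hn W V
  have hsplit : ∑ s ∈ (univ : Finset (Finset β)).filter (fun s => #s < m + 1), (((if s ∈ W then (1 : ℤ) else 0) - (if sᶜ ∈ W then (1 : ℤ) else 0))) * (((if s ∈ V then (1 : ℤ) else 0) - (if sᶜ ∈ V then (1 : ℤ) else 0)))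
      = ∑ s ∈ (univ : Finset (Finset β)).filter (fun s => #s < m), (((if s ∈ W then (1 : ℤ) else 0) - (if sᶜ ∈ W then (1 : ℤ) else 0))) * (((if s ∈ V then (1 : ℤ) else 0) - (if sᶜ ∈ V then (1 : ℤ) else 0)))
        + ∑ s ∈ (univ : Finset (Finset β)).filter (fun s => #s = m), (((if s ∈ W then (1 : ℤ) else 0) - (if sᶜ ∈ W then (1 : ℤ) else 0))) * (((if s ∈ V then (1 : ℤ) else 0) - (if sᶜ ∈ V then (1 : ℤ) else 0))) := by
    rw [← sum_union]
    · congr 1; ext s; simp only [mem_filter, mem_univ, true_and, mem_union]; omega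
    · rw [disjoint_filter]; intro s _ h1 h2; omega
  -- 2 * C(2m+1, m) ≤ 2^(2m+1)
  have hchoose : 2 * ((2 * m + 1).choose m) ≤ 2 ^ (2 * m + 1) := by
    have h1 : ((2 * m + 1).choose m) + ((2 * m + 1).choose (m + 1)) ≤ ∑ j ∈ range (2 * m + 1 + 1), (2 * m + 1).choose j := by
      have hsub : ({m, m + 1} : Finset ℕ) ⊆ range (2 * m + 1 + 1) := by
        intro j hj; rw [mem_insert, mem_singleton] at hj; rw [mem_range]; omega
      have := sum_le_sum_of_subset_of_nonneg hsub (f := fun j => (2 * m + 1).choose j) (fun _ _ _ => Nat.zero_le _)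
      rwa [sum_pair (by omega)] at this
    rw [Nat.sum_range_choose] at h1
    have h2 : (2 * m + 1).choose (m + 1) = (2 * m + 1).choose m := by
      rw [← Nat.choose_symm (by omega : m ≤ 2 * m + 1)]; congr 1; omega
    omega
  have hchooseZ : (2 : ℤ) * ((((2 * m + 1).choose m : ℕ) : ℤ)) ≤ (2 : ℤ) ^ (2 * m + 1) := by exact_mod_cast hchoose
  set P := ∑ s ∈ (univ : Finset (Finset β)).filter (fun s => #s < m), (((if s ∈ W then (1 : ℤ) else 0) - (if sᶜ ∈ W then (1 : ℤ) else 0))) * (((if s ∈ V then (1 : ℤ) else 0) - (if sᶜ ∈ V then (1 : ℤ) else 0)))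
  set S := ∑ s ∈ (univ : Finset (Finset β)).filter (fun s => #s = m), (((if s ∈ W then (1 : ℤ) else 0) - (if sᶜ ∈ W then (1 : ℤ) else 0))) * (((if s ∈ V then (1 : ℤ) else 0) - (if sᶜ ∈ V then (1 : ℤ) else 0)))
  set T := ∑ s ∈ (univ : Finset (Finset β)), (((if s ∈ W then (1 : ℤ) else 0) - (if sᶜ ∈ W then (1 : ℤ) else 0))) * (((if s ∈ V then (1 : ℤ) else 0) - (if sᶜ ∈ V then (1 : ℤ) else 0)))
  rw [hsplit] at hhalf
  -- T = 2(P+S), T ≥ 0, 2^n S ≤ C T, 2C ≤ 2^n  ⇒  P ≥ 0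
  have hCnn : (0 : ℤ) ≤ (((2 * m + 1).choose m : ℕ) : ℤ) := by exact_mod_cast Nat.zero_le _
  have hpow : (0 : ℤ) < (2 : ℤ) ^ (2 * m + 1) := by positivity
  nlinarith

/-- **(MID) ⇒ (AB_m)(2m+1)** in the lane's form: `n = 2m+1`, `W, V` upper sets of finsets of `β`; if `2^n·S_m ≤ C(n,m)·∑_all ψ_Wψ_V` then
`#{s ∈ W ∩ Vᶜˢ | #s < m ∨ #sᶜ < m} ≤ #{s ∈ W ∩ V | #s < m ∨ #sᶜ < m}`. [this work] -/
theorem antiBand_of_mid (m : ℕ) (hn : Fintype.card β = 2 * m + 1) (W V : Finset (Finset β))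
    (hW : IsUpperSet (W : Set (Finset β))) (hV : IsUpperSet (V : Set (Finset β)))
    (hmid : (2 : ℤ) ^ (2 * m + 1) * ∑ s ∈ (univ : Finset (Finset β)).filter (fun s => #s = m), (((if s ∈ W then (1 : ℤ) else 0) - (if sᶜ ∈ W then (1 : ℤ) else 0))) * (((if s ∈ V then (1 : ℤ) else 0) - (if sᶜ ∈ V then (1 : ℤ) else 0)))
        ≤ (((2 * m + 1).choose m : ℕ) : ℤ) * ∑ s ∈ (univ : Finset (Finset β)), (((if s ∈ W then (1 : ℤ) else 0) - (if sᶜ ∈ W then (1 : ℤ) else 0))) * (((if s ∈ V then (1 : ℤ) else 0) - (if sᶜ ∈ V then (1 : ℤ) else 0)))) :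
    #((W ∩ Vᶜˢ).filter fun s => #s < m ∨ #sᶜ < m) ≤ #((W ∩ V).filter fun s => #s < m ∨ #sᶜ < m) := by
  rw [antiBand_iff_outerSum_nonneg, outerSum_eq_two_mul_ballSum m (by omega) W V]
  have := ballSum_nonneg_of_mid m hn W V hW hV hmid
  linarith

/-- **(LEV_k..LEV_m) ⇒ (AB_k)(2m+1)** in the lane's form. [this work] -/
theorem antiBand_of_levelBall_odd (m : ℕ) (hn : Fintype.card β = 2 * m + 1) (W V : Finset (Finset β))
    (hW : IsUpperSet (W : Set (Finset β))) (hV : IsUpperSet (V : Set (Finset β))) (k : ℕ) (hk : k ≤ m)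
    (hlev : ∀ j, k ≤ j → j ≤ m →
      (#((univ : Finset (Finset β)).filter fun s => #s < j) : ℤ) * ∑ s ∈ (univ : Finset (Finset β)).filter (fun s => #s = j), (((if s ∈ W then (1 : ℤ) else 0) - (if sᶜ ∈ W then (1 : ℤ) else 0))) * (((if s ∈ V then (1 : ℤ) else 0) - (if sᶜ ∈ V then (1 : ℤ) else 0)))
        ≤ (((Fintype.card β).choose j : ℕ) : ℤ) * ∑ s ∈ (univ : Finset (Finset β)).filter (fun s => #s < j), (((if s ∈ W then (1 : ℤ) else 0) - (if sᶜ ∈ W then (1 : ℤ) else 0))) * (((if s ∈ V then (1 : ℤ) else 0) - (if sᶜ ∈ V then (1 : ℤ) else 0)))) :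
    #((W ∩ Vᶜˢ).filter fun s => #s < k ∨ #sᶜ < k) ≤ #((W ∩ V).filter fun s => #s < k ∨ #sᶜ < k) := by
  rw [antiBand_iff_outerSum_nonneg, outerSum_eq_two_mul_ballSum k (by omega) W V]
  have := ballSum_nonneg_of_levelBall_odd m hn W V hW hV k (by omega) hlev
  linarith

end Summit.CriticalPhenomena.PercolationContinuityZ3.Theorems.AntiBandLevelBall
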